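import Summits.BirchSwinnertonDyer.Rank1Residual.X11b.KummerPoitouTateExact
import Summits.BirchSwinnertonDyer.Rank1Residual.X11b.LocalPrimaryCohomologyEP
import Summits.BirchSwinnertonDyer.Rank1Residual.X11b.BDPRouteSelmerLevelBound
import Literature.NumberTheory.GaloisCohomology.PoitouTateSelmerCountProofs
import Summits.BirchSwinnertonDyer.Rank1Residual.Additive.AdicIntegersQuotientPrimePowCard
import Mathlib.Algebra.CharP.Quotient
import HarnessLib

/-!
# The RELAXED KUMMER SELMER COUNT at one finite place over ANY number field (real places allowed),
# from Poitou–Tate for Selmer structures: `#E(K_𝔮)[p^k] · #(𝓞_𝔮/p^k) ≤ #H¹_{𝓛, ⊤ at 𝔮 and ∞}(K, E[p^k])`,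
# hence `p^k ≤ #H¹_{𝓛, ⊤ at 𝔮}(K, E[p^k]) · ∏_{w∣∞} #H¹(K_w, E)` at `𝔮 ∣ p`

Route `ThetaPartnerAtTwo` (TP2), crux K4 `SignedControlAtTwo` (stmt-BirchSwinnertonDyer-20309), line `eulerchar`
v8; width seat `bsd-wall-tp2-p3-w2` g4 (`--supports stmt-BirchSwinnertonDyer-20309`, helper). Programme
«(I1) ⟸ Poitou–Tate»: the registered stub's third conjunct (Greenberg Thm. 1.7,
`SelmerDualData.not_isTorsion_of_supersingular`) is the tree assembly `not_isTorsion_of_supersingular_holds_of`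
of the two CLOSED named facts (I2) `CoatesGreenberg1996_H1_formalGroup_trivial` and (I1)
`WeierstrassCurve.relaxedSelmer_torsion_card_growth` — the finite-level global-duality Selmer count «at level `K_n`
the `p^k`-torsion classes of `H¹(K_n, E[p^∞])` with the Selmer conditions off `v` number `≥ p^{k pⁿ}/c(n)`»
(Greenberg LNM 1716 p. 62 "`corank_{ℤ_p}(Sel_E(F_n)_p) ≥ r(E,F) pⁿ`", via NSW (8.7.9) / DDT Thm. 2.19). This file
proves the LEVEL-`n = 0` ENGINE of that count over EVERY number field from the tree's canonical Poitou–Tate fact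
`GaloisCohomology.poitouTate_selmerStructure_duality K` ALONE (Howard 2004 Thm. 2.1.11 / Milne I Thm. 4.10),
with the archimedean places handled (the existing exact relaxation index
`X11b.KummerPT.relIndex_selmerGroup_kummerOutside_mul_natCard_map_eq_of_facts` assumes ALL infinite places complex,
which excludes `ℚ` and its totally real layers `ℚ_n` — the habitat of K4).

## What is proved (theorems only; `K : Type` any number field, `E = W` elliptic, `p` prime, `k ≥ 1`, `𝔮` finite)

* `natCard_kummerSelmerStructure_le_natCard_kummerOutside` — **`#𝓛_𝔮 ≤ #H¹_{𝓛, ⊤ at 𝔮 and ∞}(K, E[p^k])`**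
  (`𝓛_𝔮 = kummerSelmerStructure W (p^k) 𝔮` the local Kummer condition, the right side
  `kummerOutside W (p^k) ({𝔮} ∪ ∞)` = classes of `H¹(K, E[p^k])` with the Kummer condition at every FINITE place
  `≠ 𝔮`). Proof: the COUNTING FORM of Poitou–Tate for Selmer structures (tree theorem
  `natCard_selmerQuotient_mul_of_poitouTate`, Milne I 4.10 ⟹ `#(H¹_𝓖/H¹_𝓕)·#(H¹_{𝓕*}/H¹_{𝓖*})·∏#𝓕_v = ∏#𝓖_v`)
  for `𝓕 =` Kummer relaxed at `∞` (`kummerRelaxed W (p^k) ∞`) `≤ 𝓖 =` Kummer relaxed at `∞ ∪ {𝔮}`, unramified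
  outside a finite `T ⊇ ∞ ∪ {v∣p} ∪ bad ∪ {𝔮}` (X11b `kummerRelaxed_isUnramifiedOutside`,
  `isUnramifiedAt_torsionGaloisModule`); the products cancel except at `𝔮`, where `#𝓖_𝔮 = #H¹(K_𝔮, E[p^k]) = (#𝓛_𝔮)²`
  (Tate's local Euler characteristic, tree theorem `natCard_galoisCohomology_one_torsion_adicCompletion_eq_sqEP`), so
  `#(H¹_𝓖/H¹_𝓕)·#(H¹_{𝓕*}/H¹_{𝓖*}) = #𝓛_𝔮`; and **`#(H¹_{𝓕*}/H¹_{𝓖*}) ≤ #H¹_{𝓕*}(K, E[p^k]^D) ≤ #H¹_𝓕(K, E[p^k])`** because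
  the inverse Weil transport `H¹(w⁻¹)` (X11b `weilDualInv`, tree Weil pairing `exists_weilPairing_holds`) is injective
  and carries the dual Selmer group of `𝓕` into the Selmer group of `𝓕`: at a FINITE place the dual of the Kummer
  condition goes into the Kummer condition (X11b `map_weilDualInv_mem_kummer_of_mem_dualLocalCondition`: Poonen–Rains
  isotropy `kummerClass_cupProduct_kummerClass_eq_zero_holds` + Tate's count), and at an INFINITE place `𝓕` imposes
  nothing — which is why no hypothesis on the (unconstrained) archimedean members `inv_w` of the Poitou–Tate family
  and no «totally complex» hypothesis is needed. Hence `#𝓛_𝔮 ≤ #(H¹_𝓖/H¹_𝓕)·#H¹_𝓕 = #H¹_𝓖`.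
* `prime_dvd_natCard_quot_adicCompletionIntegers`, `prime_pow_le_natCard_quot_adicCompletionIntegers` —
  `p ∣ #(𝓞_v/p)` and `p^k ≤ #(𝓞_v/p^k)` at `v ∋ p` (`p` is a non-unit of `𝓞_v`, characteristic-`p` quotient).
* `natCard_torsion_mul_natCard_quot_le_natCard_kummerOutside` (`#𝓛_𝔮 = #E(K_𝔮)[p^k]·#(𝓞_𝔮/p^k)`, Milne I 3.3, tree
  `natCard_kummerSelmerStructure_inr`), `prime_pow_le_natCard_kummerOutside` (`p^k ≤ #H¹_{𝓛, ⊤ at 𝔮 and ∞}` at `𝔮 ∣ p`).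
(The sequel `…RelaxedKummerCountLevelZero` imposes the Kummer condition at the archimedean places as well —
`#𝓛_𝔮 ≤ #H¹_{𝓛, ⊤ at 𝔮}(K, E[p^k]) · ∏_{w∣∞} #H¹(K_w, E(K̄_w))`, a constant independent of `k` — and transports the
count into the `subgroupH1`/`localKerOver` currency of (I1) at level `0`.)

HONEST FRAMING: THEOREMS ONLY (no definition, no named fact, no `sorry`), CONDITIONAL on the named Poitou–Tate fact
`poitouTate_selmerStructure_duality K` taken as a hypothesis; it is the level-`0` engine of (I1), NOT (I1) (the
layers `K_n`, `n ≥ 1`, and the transport to the `subgroupH1`/`localKerOver`/`conjH1` currency of (I1) are the next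
files); closes nothing; BSD is not proved by any of this.

References: [cite: GreenbergLNM1716, Thm 1.7 and the paragraph after it (pp. 61–62)] [cite: MilneADT2006, Ch. I, Cor. 2.3,
Thm. 2.8, Lemma 3.3, Rem. 3.7, Thm. 4.10] [cite: Howard2004HeegnerKolyvagin, Def. 2.1.10, Thm. 2.1.11 (arXiv:1202.6340 p. 6)]
[cite: PoonenRains2012, Prop. 4.10] [cite: NeukirchSchmidtWingberg2008, (8.7.9)].
-/

set_option linter.dupNamespace false

noncomputable section

open scoped Classical
open CategoryTheory Field NumberField IsDedekindDomain Function
open Literature.NumberTheory.EllipticCurves Literature.NumberTheory.EllipticCurves.GreenbergSelmer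
open Literature.NumberTheory.GaloisRepresentations
open Literature.NumberTheory.GaloisRepresentations.DiscreteGaloisModule (SelmerStructure TateDual
  tateDual localTatePairingZMod unramifiedSubgroup mu MuCarrier)
open Literature.NumberTheory.GaloisCohomology
open scoped ContRepresentation

namespace Summit.BirchSwinnertonDyer.BirchSwinnertonDyer.Theorems.SignedEC.RelaxedKummerCount

open Summit.BirchSwinnertonDyer.Rank1Residual.X11b.KummerPT
open Summit.BirchSwinnertonDyer.Rank1Residual.X11b.LocBridge
open Summit.BirchSwinnertonDyer.Rank1Residual.X11b.Levels
open Summit.BirchSwinnertonDyer.Rank1Residual.X11b.AcSelmer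
open Summit.BirchSwinnertonDyer.Rank1Residual.X11b.SelmerLevelBound

variable {K : Type} [Field K] [NumberField K] (W : WeierstrassCurve K) [W.IsElliptic] (p k : ℕ)
  [Fact p.Prime]

omit [NumberField K] in
/-- Every infinite place lies in the finite set `Finset.univ.image Sum.inl` of archimedean places. [folklore] -/
theorem inl_mem_image_inl [NumberField K] (w : InfinitePlace K) :
    (Sum.inl w : Place K) ∈ (Finset.univ.image Sum.inl : Finset (Place K)) :=
  Finset.mem_image.mpr ⟨w, Finset.mem_univ _, rfl⟩

omit [NumberField K] in
/-- No finite place lies in the set of archimedean places. [folklore] -/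
theorem inr_not_mem_image_inl [NumberField K] (v : HeightOneSpectrum (𝓞 K)) :
    (Sum.inr v : Place K) ∉ (Finset.univ.image Sum.inl : Finset (Place K)) := by
  intro h
  obtain ⟨w, -, hw⟩ := Finset.mem_image.mp h
  exact Sum.inl_ne_inr hw

/-- **THE RELAXED KUMMER COUNT over any number field: `#𝓛_𝔮 ≤ #H¹_{𝓛, ⊤ at 𝔮 and ∞}(K, E[p^k])`** for
`E = W` elliptic over a number field `K` (real places allowed), a prime `p`, `k ≥ 1`, any finite place `𝔮`,
GIVEN Poitou–Tate for Selmer structures (`poitouTate_selmerStructure_duality K`). Milne I Thm. 4.10 counting form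
for `kummerRelaxed ∞ ≤ kummerRelaxed (∞ ∪ {𝔮})`, Tate's local count `#H¹(K_𝔮, E[p^k]) = (#𝓛_𝔮)²` at `𝔮`, and the
inverse Weil transport injecting `H¹_{𝓕*}(K, E[p^k]^D)` into `H¹_𝓕(K, E[p^k])` (finite places: the dual of the
Kummer condition is inside the Kummer condition; infinite places: no condition). See the module docstring.
[cite: MilneADT2006, Ch. I, Thm. 4.10, Thm. 2.8, Cor. 3.4] [cite: Howard2004HeegnerKolyvagin, Thm. 2.1.11 (arXiv:1202.6340 p. 6)]
[cite: PoonenRains2012, Prop. 4.10] -/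
theorem natCard_kummerSelmerStructure_le_natCard_kummerOutside (hk : 0 < k)
    (hPT : poitouTate_selmerStructure_duality K) (𝔮 : HeightOneSpectrum (𝓞 K)) :
    Nat.card (W.kummerSelmerStructure ((p ^ k : ℕ) : ℤ) (Sum.inr 𝔮)) ≤
      Nat.card (kummerOutside W (p ^ k) (insert (Sum.inr 𝔮) (Finset.univ.image Sum.inl))) := by
  classical
  have hprime : p.Prime := Fact.out
  haveI : NeZero (p ^ k) := ⟨pow_ne_zero k hprime.ne_zero⟩
  haveI : Finite (W.geomTorsion ((p ^ k : ℕ) : ℤ)) := finite_geomTorsion_of_neZero W _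
  haveI : CompactSpace (absoluteGaloisGroup K) := absoluteGaloisGroup_compactSpace K
  have hpp : IsPrimePow (p ^ k) := ⟨p, k, hprime.prime, hk, rfl⟩
  have hp2 : 2 ≤ p ^ k := le_trans hprime.two_le (Nat.le_self_pow hk.ne' p)
  have hchar : ((p ^ k : ℕ) : K) ≠ 0 := Nat.cast_ne_zero.mpr (pow_ne_zero _ hprime.ne_zero)
  obtain ⟨e, hμ, hadd₁, hadd₂, halt, hnondeg, hgal⟩ := W.exists_weilPairing_holds (p ^ k) hp2 hchar
  obtain ⟨inv, hperf, hsum, -, hcompl⟩ := hPT (p ^ k)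
  have hEuler : ∀ v : HeightOneSpectrum (𝓞 K),
      Nat.card (galoisCohomology ((W.torsionGaloisModule ((p ^ k : ℕ) : ℤ)).toLocal (Sum.inr v)) 1) =
        (Nat.card (nsmulAddMonoidHom (p ^ k) :
            (W.baseChange (v.adicCompletion K)).toAffine.Point →+ _).ker *
          Nat.card (v.adicCompletionIntegers K ⧸
            Ideal.span {((p ^ k : ℕ) : v.adicCompletionIntegers K)})) ^ 2 := fun v ↦
    natCard_galoisCohomology_one_torsion_adicCompletion_eq_sqEP W v (p ^ k) hpp
  -- the two relaxed structures
  set R : Finset (Place K) := Finset.univ.image Sum.inl with hR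
  set S' : Finset (Place K) := insert (Sum.inr 𝔮) R with hS'
  set ρ := W.torsionGaloisModule ((p ^ k : ℕ) : ℤ) with hρ
  set 𝓕 : SelmerStructure ρ := kummerRelaxed W (p ^ k) R with h𝓕def
  set 𝓖 : SelmerStructure ρ := kummerRelaxed W (p ^ k) S' with h𝓖def
  have hRS' : R ⊆ S' := Finset.subset_insert _ _
  have hle : 𝓕 ≤ 𝓖 := by
    intro v
    by_cases hv : v ∈ R
    · rw [h𝓕def, h𝓖def, kummerRelaxed_of_mem W (p ^ k) R hv, kummerRelaxed_of_mem W (p ^ k) S' (hRS' hv)]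
    · rw [h𝓕def, kummerRelaxed_of_not_mem W (p ^ k) R hv]
      by_cases hv' : v ∈ S'
      · rw [h𝓖def, kummerRelaxed_of_mem W (p ^ k) S' hv']; exact le_top
      · rw [h𝓖def, kummerRelaxed_of_not_mem W (p ^ k) S' hv']
  -- exceptional set
  obtain ⟨T, hS'T, hinf, hp, hbad⟩ := exists_exceptional_finset W p S'
  have hMn : ∀ m : W.geomTorsion ((p ^ k : ℕ) : ℤ), (p ^ k) • m = 0 := fun m ↦
    AddSubgroup.torsionBy.nsmul m
  have hTout : ∀ v : HeightOneSpectrum (𝓞 K), (Sum.inr v : Place K) ∉ T →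
      ((p ^ k : ℕ) : 𝓞 K) ∉ v.asIdeal ∧
        GaloisRep.IsUnramifiedAt v (W.torsionGaloisModule ((p ^ k : ℕ) : ℤ)) := by
    intro v hv
    have hpv : ((p : ℕ) : 𝓞 K) ∉ v.asIdeal := fun h ↦ hv (hp v h)
    have hgood : W.HasGoodReductionAt v := by
      by_contra hbad'
      exact hv (hbad v hbad')
    exact ⟨natCast_pow_not_mem p hpv _,
      isUnramifiedAt_torsionGaloisModule W hgood (intCast_pow_not_mem p hpv _)⟩
  have h𝓕 : 𝓕.IsUnramifiedOutside T :=
    kummerRelaxed_isUnramifiedOutside W p k R T (hRS'.trans hS'T) hinf hp hbad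
  have h𝓖 : 𝓖.IsUnramifiedOutside T :=
    kummerRelaxed_isUnramifiedOutside W p k S' T hS'T hinf hp hbad
  have hinfeq : ∀ w : InfinitePlace K, 𝓕 (Sum.inl w) = 𝓖 (Sum.inl w) := fun w ↦ by
    rw [h𝓕def, h𝓖def, kummerRelaxed_of_mem W (p ^ k) R (inl_mem_image_inl w),
      kummerRelaxed_of_mem W (p ^ k) S' (hRS' (inl_mem_image_inl w))]
  set Sf : Finset (HeightOneSpectrum (𝓞 K)) := T.preimage Sum.inr (Sum.inr_injective.injOn) with hSf
  have hSfmem : ∀ v, v ∈ Sf ↔ (Sum.inr v : Place K) ∈ T := fun v ↦ by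
    rw [hSf, Finset.mem_preimage]
  -- Poitou–Tate, counting form
  have key := natCard_selmerQuotient_mul_of_poitouTate hperf hsum hcompl ρ hMn T hTout hle h𝓕 h𝓖 hinfeq Sf
    hSfmem
  -- abbreviations
  set L := W.kummerSelmerStructure ((p ^ k : ℕ) : ℤ) (Sum.inr 𝔮) with hL
  have h𝔮S' : (Sum.inr 𝔮 : Place K) ∈ S' := Finset.mem_insert_self _ _
  have h𝔮Sf : 𝔮 ∈ Sf := (hSfmem 𝔮).mpr (hS'T h𝔮S')
  have h𝓕𝔮 : 𝓕 (Sum.inr 𝔮) = L := by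
    rw [h𝓕def, kummerRelaxed_of_not_mem W (p ^ k) R (inr_not_mem_image_inl 𝔮)]
  have h𝓖𝔮 : 𝓖 (Sum.inr 𝔮) = ⊤ := by
    rw [h𝓖def, kummerRelaxed_of_mem W (p ^ k) S' h𝔮S']
  have hoff : ∀ v ∈ Sf.erase 𝔮, 𝓕 (Sum.inr v) = 𝓖 (Sum.inr v) := by
    intro v hv
    have hne : v ≠ 𝔮 := Finset.ne_of_mem_erase hv
    have hvS' : (Sum.inr v : Place K) ∉ S' := by
      rw [hS', Finset.mem_insert, not_or]
      exact ⟨fun h ↦ hne (Sum.inr_injective h), inr_not_mem_image_inl v⟩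
    rw [h𝓕def, h𝓖def, kummerRelaxed_of_not_mem W (p ^ k) R (inr_not_mem_image_inl v),
      kummerRelaxed_of_not_mem W (p ^ k) S' hvS']
  -- local finiteness and the local count at `𝔮`
  haveI hfinloc : ∀ v : HeightOneSpectrum (𝓞 K),
      Finite (galoisCohomology (ρ.toLocal (Sum.inr v)) 1) := fun v ↦
    finite_galoisCohomology_toLocal_inr W (p ^ k) v
  have hLcard : Nat.card L = Nat.card (nsmulAddMonoidHom (p ^ k) :
        (W.baseChange (𝔮.adicCompletion K)).toAffine.Point →+ _).ker *
      Nat.card (𝔮.adicCompletionIntegers K ⧸ Ideal.span {((p ^ k : ℕ) : 𝔮.adicCompletionIntegers K)}) :=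
    W.natCard_kummerSelmerStructure_inr 𝔮 (NeZero.ne (p ^ k))
  have htop : Nat.card (𝓖 (Sum.inr 𝔮)) = Nat.card L * Nat.card L := by
    rw [h𝓖𝔮, AddSubgroup.card_top, hEuler 𝔮, hLcard, sq]
  have hLpos : 0 < Nat.card L := Nat.card_pos
  -- split the products at `𝔮`
  set P := ∏ v ∈ Sf.erase 𝔮, Nat.card (𝓕 (Sum.inr v)) with hP
  have hPpos : 0 < P := Finset.prod_pos fun v _ ↦ Nat.card_pos
  have hprodF : ∏ v ∈ Sf, Nat.card (𝓕 (Sum.inr v)) = Nat.card L * P := by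
    rw [← Finset.mul_prod_erase Sf (fun v ↦ Nat.card (𝓕 (Sum.inr v))) h𝔮Sf, h𝓕𝔮]
  have hPeq : ∏ v ∈ Sf.erase 𝔮, Nat.card (𝓖 (Sum.inr v)) = P :=
    Finset.prod_congr rfl fun v hv ↦ by rw [hoff v hv]
  have hprodG : ∏ v ∈ Sf, Nat.card (𝓖 (Sum.inr v)) = Nat.card L * Nat.card L * P := by
    rw [← Finset.mul_prod_erase Sf (fun v ↦ Nat.card (𝓖 (Sum.inr v))) h𝔮Sf, htop, hPeq]
  -- the two indices
  set a := Nat.card (𝓖.selmerGroup ⧸ (𝓕.selmerGroup).addSubgroupOf 𝓖.selmerGroup) with ha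
  set b := Nat.card ((inv.dualSelmerStructure ρ 𝓕).selmerGroup ⧸
    ((inv.dualSelmerStructure ρ 𝓖).selmerGroup).addSubgroupOf (inv.dualSelmerStructure ρ 𝓕).selmerGroup) with hb
  have hab : a * b = Nat.card L := by
    rw [hprodF, hprodG] at key
    have key' : a * b * (Nat.card L * P) = Nat.card L * (Nat.card L * P) := by rw [key]; ring
    exact Nat.eq_of_mul_eq_mul_right (Nat.mul_pos hLpos hPpos) key'
  -- finiteness of the Selmer groups
  haveI hfinG : Finite 𝓖.selmerGroup := by
    rw [h𝓖def, selmerGroup_kummerRelaxed]; exact finite_kummerOutside W (p ^ k) S'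
  haveI hfinF : Finite 𝓕.selmerGroup := by
    rw [h𝓕def, selmerGroup_kummerRelaxed]; exact finite_kummerOutside W (p ^ k) R
  -- the dual Selmer group of `𝓕` injects into the Selmer group of `𝓕` by the inverse Weil transport
  have hto : ∀ y ∈ (inv.dualSelmerStructure ρ 𝓕).selmerGroup,
      galoisCohomology.map (weilDualInv W (p ^ k) e hμ hadd₁ hadd₂ hgal hnondeg) 1 y ∈ 𝓕.selmerGroup := by
    intro y hy
    rw [SelmerStructure.mem_selmerGroup_iff] at hy ⊢
    intro v
    rw [show galoisCohomology.localization ρ v 1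
        (galoisCohomology.map (weilDualInv W (p ^ k) e hμ hadd₁ hadd₂ hgal hnondeg) 1 y) =
        galoisCohomology.map ((weilDualInv W (p ^ k) e hμ hadd₁ hadd₂ hgal hnondeg).restrictField
          (Place.Completion v)) 1 (galoisCohomology.localization (ρ.tateDual (p ^ k)) v 1 y) from
      galoisCohomology.res_map_one (Place.Completion v) (weilDualInv W (p ^ k) e hμ hadd₁ hadd₂ hgal hnondeg) y]
    cases v with
    | inl w =>
      rw [h𝓕def, kummerRelaxed_of_mem W (p ^ k) R (inl_mem_image_inl w)]
      exact AddSubgroup.mem_top _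
    | inr v =>
      have hyv := hy (Sum.inr v)
      rw [LocalInvariants.dualSelmerStructure_apply, h𝓕def,
        kummerRelaxed_of_not_mem W (p ^ k) R (inr_not_mem_image_inl v)] at hyv
      rw [h𝓕def, kummerRelaxed_of_not_mem W (p ^ k) R (inr_not_mem_image_inl v)]
      exact map_weilDualInv_mem_kummer_of_mem_dualLocalCondition W (p ^ k) e hμ hadd₁ hadd₂ hgal halt
        hnondeg inv v (hperf v).1.1 (hEuler v) hyv
  set φ : (inv.dualSelmerStructure ρ 𝓕).selmerGroup → 𝓕.selmerGroup := fun y ↦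
    ⟨galoisCohomology.map (weilDualInv W (p ^ k) e hμ hadd₁ hadd₂ hgal hnondeg) 1 y.1, hto y.1 y.2⟩ with hφ
  have hφinj : Injective φ := by
    intro y y' h
    apply Subtype.ext
    have h1 := congrArg Subtype.val h
    exact map_injective_of_comp_eq _ _
      (weilDualIntertwining_weilDualInv W (p ^ k) e hμ hadd₁ hadd₂ hgal hnondeg) h1
  haveI hfinFd : Finite (inv.dualSelmerStructure ρ 𝓕).selmerGroup := Finite.of_injective φ hφinj
  have hb_le : b ≤ Nat.card 𝓕.selmerGroup :=
    (Nat.card_le_card_of_surjective _ (QuotientAddGroup.mk_surjective)).trans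
      (Nat.card_le_card_of_injective φ hφinj)
  -- Lagrange in `H¹_𝓖`
  have hFG : 𝓕.selmerGroup ≤ 𝓖.selmerGroup := by
    intro x hx
    rw [SelmerStructure.mem_selmerGroup_iff] at hx ⊢
    exact fun v ↦ hle v (hx v)
  have hlag : Nat.card 𝓖.selmerGroup = a * Nat.card 𝓕.selmerGroup := by
    rw [ha, AddSubgroup.card_eq_card_quotient_mul_card_addSubgroup ((𝓕.selmerGroup).addSubgroupOf 𝓖.selmerGroup),
      Nat.card_congr (AddSubgroup.addSubgroupOfEquivOfLe hFG).toEquiv]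
  -- assemble
  rw [← selmerGroup_kummerRelaxed W (p ^ k) S']
  change Nat.card L ≤ Nat.card 𝓖.selmerGroup
  calc Nat.card L = a * b := hab.symm
    _ ≤ a * Nat.card 𝓕.selmerGroup := Nat.mul_le_mul_left a hb_le
    _ = Nat.card 𝓖.selmerGroup := hlag.symm

/-! ## `p^k ≤ #(𝓞_𝔮 ⧸ p^k)` at a place `𝔮 ∣ p` -/

omit [NumberField K] in
/-- **`p ∣ #(𝓞_v ⧸ p)` at a finite place `v ∋ p`** of a number field: `p` is not a unit of `𝓞_v`
(`‖p‖_v < 1`), so `𝓞_v ⧸ (p)` is a non-trivial ring of characteristic `p` and the additive order of `1`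
(namely `p`) divides its (finite) order. [folklore] -/
theorem prime_dvd_natCard_quot_adicCompletionIntegers [NumberField K] {v : HeightOneSpectrum (𝓞 K)}
    (hv : ((p : ℕ) : 𝓞 K) ∈ v.asIdeal) :
    p ∣ Nat.card (v.adicCompletionIntegers K ⧸ Ideal.span {((p : ℕ) : v.adicCompletionIntegers K)}) := by
  have hprime : p.Prime := Fact.out
  have hnu : ¬ IsUnit ((p : ℕ) : v.adicCompletionIntegers K) := by
    rw [LocalPoints.isUnit_iff_valuation_eq_one]
    have hlt := LocalPoints.valuation_natCast_lt_one (K := K) v hv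
    have hcoe : (((p : ℕ) : v.adicCompletionIntegers K) : v.adicCompletion K) = (p : v.adicCompletion K) := by
      simp
    rw [hcoe]
    exact hlt.ne
  haveI hchar : CharP (v.adicCompletionIntegers K ⧸ Ideal.span {((p : ℕ) : v.adicCompletionIntegers K)}) p :=
    CharP.quotient (v.adicCompletionIntegers K) p (mem_nonunits_iff.mpr hnu)
  haveI : Nontrivial (v.adicCompletionIntegers K ⧸ Ideal.span {((p : ℕ) : v.adicCompletionIntegers K)}) :=
    Ideal.Quotient.nontrivial_iff.mpr (by rwa [Ne, Ideal.span_singleton_eq_top])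
  have h1 : addOrderOf (1 : v.adicCompletionIntegers K ⧸ Ideal.span {((p : ℕ) : v.adicCompletionIntegers K)}) = p :=
    CharP.eq _ (CharP.addOrderOf_one _) hchar
  have h2 := addOrderOf_dvd_natCard
    (1 : v.adicCompletionIntegers K ⧸ Ideal.span {((p : ℕ) : v.adicCompletionIntegers K)})
  rwa [h1] at h2

omit [NumberField K] in
/-- **`p^k ≤ #(𝓞_v ⧸ p^k)` at a finite place `v ∋ p`** (indeed `#(𝓞_v ⧸ p^k) = #(𝓞_v ⧸ p)^k` and
`p ∣ #(𝓞_v ⧸ p)`; with equality `p^{k[K_v:ℚ_p]}`, not needed here). [folklore] -/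
theorem prime_pow_le_natCard_quot_adicCompletionIntegers [NumberField K] {v : HeightOneSpectrum (𝓞 K)}
    (hv : ((p : ℕ) : 𝓞 K) ∈ v.asIdeal) (k : ℕ) :
    p ^ k ≤ Nat.card (v.adicCompletionIntegers K ⧸ Ideal.span {((p ^ k : ℕ) : v.adicCompletionIntegers K)}) := by
  have hprime : p.Prime := Fact.out
  rw [Summit.BirchSwinnertonDyer.Rank1Residual.Additive.DefectCountFiniteLevel.natCard_quot_adicCompletionIntegers_natCast_pow
    v hprime.ne_zero k]
  refine Nat.pow_le_pow_left (Nat.le_of_dvd ?_ (prime_dvd_natCard_quot_adicCompletionIntegers p hv)) k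
  exact Nat.pos_of_ne_zero (LocalPoints.card_quotient_span_natCast_ne_zero v hprime.ne_zero)

/-! ## Corollaries: the count with the local factor unfolded, and at a place above `p` -/

/-- **`#E(K_𝔮)[p^k] · #(𝓞_𝔮/p^k) ≤ #H¹_{𝓛, ⊤ at 𝔮 and ∞}(K, E[p^k])`** — the relaxed Kummer count with
the order of the local Kummer condition unfolded (Milne I Lemma 3.3, tree
`natCard_kummerSelmerStructure_inr`). [cite: MilneADT2006, Ch. I, Lemma 3.3 and Thm. 4.10] -/
theorem natCard_torsion_mul_natCard_quot_le_natCard_kummerOutside (hk : 0 < k)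
    (hPT : poitouTate_selmerStructure_duality K) (𝔮 : HeightOneSpectrum (𝓞 K)) :
    Nat.card (nsmulAddMonoidHom (p ^ k) : (W.baseChange (𝔮.adicCompletion K)).toAffine.Point →+ _).ker *
        Nat.card (𝔮.adicCompletionIntegers K ⧸ Ideal.span {((p ^ k : ℕ) : 𝔮.adicCompletionIntegers K)}) ≤
      Nat.card (kummerOutside W (p ^ k) (insert (Sum.inr 𝔮) (Finset.univ.image Sum.inl))) := by
  rw [← W.natCard_kummerSelmerStructure_inr 𝔮 (pow_ne_zero k (Fact.out : p.Prime).ne_zero)]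
  exact natCard_kummerSelmerStructure_le_natCard_kummerOutside W p k hk hPT 𝔮

/-- **`p^k ≤ #H¹_{𝓛, ⊤ at 𝔮 and ∞}(K, E[p^k])` at a place `𝔮 ∣ p`** — Greenberg's count
"`corank_{ℤ_p} Sel ≥ [K_v:ℚ_p]`" (LNM 1716, p. 62 / [Gr2] §4) at finite level `k`, in its weakest form
(`#(𝓞_𝔮/p^k) ≥ p^k`, `#E(K_𝔮)[p^k] ≥ 1`), over ANY number field, from Poitou–Tate alone.
[cite: GreenbergLNM1716, Thm 1.7 and the paragraph after it (pp. 61–62)] [cite: MilneADT2006, Ch. I, Thm. 4.10] -/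
theorem prime_pow_le_natCard_kummerOutside (hPT : poitouTate_selmerStructure_duality K)
    {𝔮 : HeightOneSpectrum (𝓞 K)} (h𝔮 : ((p : ℕ) : 𝓞 K) ∈ 𝔮.asIdeal) (k : ℕ) :
    p ^ k ≤ Nat.card (kummerOutside W (p ^ k) (insert (Sum.inr 𝔮) (Finset.univ.image Sum.inl))) := by
  rcases Nat.eq_zero_or_pos k with rfl | hk
  · rw [pow_zero]
    haveI : Finite (W.geomTorsion ((1 : ℕ) : ℤ)) := finite_geomTorsion_of_neZero W _
    haveI := finite_kummerOutside W 1 (insert (Sum.inr 𝔮) (Finset.univ.image Sum.inl))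
    exact Nat.card_pos
  calc p ^ k ≤ Nat.card (𝔮.adicCompletionIntegers K ⧸
        Ideal.span {((p ^ k : ℕ) : 𝔮.adicCompletionIntegers K)}) :=
        prime_pow_le_natCard_quot_adicCompletionIntegers p h𝔮 k
    _ ≤ Nat.card (nsmulAddMonoidHom (p ^ k) : (W.baseChange (𝔮.adicCompletion K)).toAffine.Point →+ _).ker *
        Nat.card (𝔮.adicCompletionIntegers K ⧸ Ideal.span {((p ^ k : ℕ) : 𝔮.adicCompletionIntegers K)}) := by
        haveI := W.finite_ker_nsmul_adicCompletion 𝔮 (pow_ne_zero k (Fact.out : p.Prime).ne_zero)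
        exact Nat.le_mul_of_pos_left _ Nat.card_pos
    _ ≤ _ := natCard_torsion_mul_natCard_quot_le_natCard_kummerOutside W p k hk hPT 𝔮

end Summit.BirchSwinnertonDyer.BirchSwinnertonDyer.Theorems.SignedEC.RelaxedKummerCount

end
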